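import Mathlib
import Summits.Ventures.HodgeRepro.Tier4.Line1.RTFSetting
import Summits.Ventures.HodgeRepro.Tier4.Line4.L1Class
import Summits.Ventures.HodgeRepro.Tier4.Line4.LevelTailInstance

/-!
# Tier4/Line4/LevelTailConv — `hsuppA` for the CONVOLUTION family: the support of `(finf ⊗ ffin N) ⋆ f₂ N` lies in the
level support set (plan-4 g5 S15231's ask on C-L4-LEVELTAIL-INST (a))

Blind re-derivation cell `pub-hodge-repro`, Tier 4 «prove the step» (README §9–§10), seat t4-L2-p1 (gen 3).  Tree path
`lean/Summits/Ventures/HodgeRepro/Tier4/Line4/LevelTailConv.lean`.  Imports `Line4/LevelTailInstance` (p705148: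
`levelSuppSet`), `Line4/L1Class` (p699130: `L1Class.prodFn`), `Line1/RTFSetting` (`RTF.Setting.conv`).  Mathlib-level.

THE BRIDGE.  `exists_ne_zero_of_conv_ne_zero`: `S.conv g h x ≠ 0 → ∃ y, g y ≠ 0 ∧ h (y⁻¹ x) ≠ 0` (the integrand of a
non-zero integral is somewhere non-zero).  `mem_levelSuppSet_conv`: for the family `f N := S.conv (prodFn finf (ffin N)) (f₂ N)`
with `TailFamily'`'s `suppFin` (`ffin N x ≠ 0 → x_f = κ₁ γ₀,f κ₂`, `κ_i ∈ K(N)`) and `suppFin₂` (`f₂ N x ≠ 0 → x_f ∈ K(N)`)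
taken VERBATIM as hypotheses, every `(t, t′)` with `f N (t⁻¹ γ t′) ≠ 0` lies in `levelSuppSet W γ₀ N γ`: write
`x = t⁻¹ γ t′`, pick `y` with `(prodFn finf (ffin N)) y ≠ 0` and `f₂ N (y⁻¹ x) ≠ 0`; then `x_f = y_f (y⁻¹ x)_f =
κ₁ γ₀,f κ₂ κ ∈ K(N) γ₀,f K(N)`.  This is the `hsuppA` binder of `exists_fibreDominated_of_level_decay_count` (LevelTail
p704492) on the convolution family, in the shape L1-p4's weighted glue consumes.

Nothing here says anything about the status of the Hodge conjecture for CM abelian varieties, which is NOT proved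
(HC_CM is NOT proved by anyone in this repository).
-/

set_option autoImplicit false
noncomputable section
namespace Summit.Ventures.HodgeRepro.Tier4.Line4
open Summit.Ventures.HodgeRepro.Tier4 Summit.Ventures.HodgeRepro.Tier4.Common
  Summit.Ventures.HodgeRepro.Tier4.Line1 MeasureTheory
open scoped Topology Pointwise NNReal ENNReal

section Conv
variable {G : Type} [Group G] [TopologicalSpace G] [IsTopologicalGroup G] [MeasurableSpace G] [BorelSpace G]
  (S : RTF.Setting G)

omit [IsTopologicalGroup G] [BorelSpace G] in
/-- The integrand of a non-zero convolution value is somewhere non-zero. -/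
theorem exists_ne_zero_of_conv_ne_zero (g h : G → ℂ) (x : G) (hx : S.conv g h x ≠ 0) :
    ∃ y : G, g y ≠ 0 ∧ h (y⁻¹ * x) ≠ 0 := by
  by_contra hcon
  push Not at hcon
  apply hx
  unfold RTF.Setting.conv
  refine integral_eq_zero_of_ae (Filter.Eventually.of_forall fun y => ?_)
  by_cases hg : g y = 0
  · simp [hg]
  · simp [hcon y hg]

end Conv

section Level
variable {k : Type} [Field k] [NumberField k] (W : PlaneData k) [MeasurableSpace (GA W)] [BorelSpace (GA W)]
  (S : RTF.Setting (GA W))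

omit [BorelSpace (GA W)] in
/-- **`hsuppA` for the convolution family**: with `TailFamily'`'s `suppFin` / `suppFin₂` at level `N`, every non-zero
value `f N (t⁻¹ γ t′)` of `f N := S.conv (prodFn finf (ffin N)) (f₂ N)` puts `(t, t′)` into `levelSuppSet W γ₀ N γ`. -/
theorem mem_levelSuppSet_conv (γ₀ : GA W) (finf : GA W → ℂ) (ffin f₂ : ℕ → GA W → ℂ) (N : ℕ)
    (hfin : ∀ x, ffin N x ≠ 0 →
      ∃ κ₁ ∈ levelK W N, ∃ κ₂ ∈ levelK W N, GA.ofFinPart W x = κ₁ * GA.ofFinPart W γ₀ * κ₂)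
    (hfin₂ : ∀ x, f₂ N x ≠ 0 → GA.ofFinPart W x ∈ levelK W N)
    (γ : GA W) (t : torusT W) (t' : torusT' W)
    (h : S.conv (L1Class.prodFn W finf (ffin N)) (f₂ N) ((t : GA W)⁻¹ * γ * (t' : GA W)) ≠ 0) :
    (t, t') ∈ levelSuppSet W γ₀ N γ := by
  obtain ⟨y, hy, hy'⟩ := exists_ne_zero_of_conv_ne_zero S _ _ _ h
  have hffin : ffin N (GA.ofFinPart W y) ≠ 0 := right_ne_zero_of_mul hy
  obtain ⟨κ₁, hκ₁, κ₂, hκ₂, hyf⟩ := hfin _ hffin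
  rw [ofFinPart_eq_self_of_mem_finitePart W (ofFinPart_mem_finitePart W y)] at hyf
  have hκ : GA.ofFinPart W (y⁻¹ * ((t : GA W)⁻¹ * γ * (t' : GA W))) ∈ levelK W N := hfin₂ _ hy'
  show GA.ofFinPart W ((t : GA W)⁻¹ * γ * (t' : GA W)) ∈ levelDoubleCoset W N (GA.ofFinPart W γ₀)
  have hx : (t : GA W)⁻¹ * γ * (t' : GA W) = y * (y⁻¹ * ((t : GA W)⁻¹ * γ * (t' : GA W))) := by group
  rw [hx, ofFinPart_mul, hyf, mul_assoc]
  exact Set.mul_mem_mul (Set.mul_mem_mul hκ₁ (Set.mem_singleton _)) (mul_mem hκ₂ hκ)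

end Level

end Summit.Ventures.HodgeRepro.Tier4.Line4

end
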